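import Summits.Parity.GeneralizedHardyLittlewood.Theorems.LeeYangFibresAbsoluteUpgradeSinglesDecaySeq
import Summits.Parity.GeneralizedHardyLittlewood.Theorems.LeeYangFibresAbsoluteUpgradeSinglesDecayDict
import HarnessLib

/-!
# Route `LeeYangFibres`, crux `PrimeCellsRelative` (stmt-Parity-14112), line `SketchIdeator4`
# (card `sieve-out-to-chowla`): helper file 1 for the stub `stub_sieveTransfer` — sieving out an arbitrary
# signed sequence (the two main terms cancel)

The sibling line's `Theorems.AbsoluteUpgrade.signed_sifted_sum_le` (crux `AbsoluteUpgrade`, helper file 7 of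
`stub_singlesDecay`) bounds the Liouville sum `Σ λ(a m + b)` of ONE form over the sifted points of an integer
interval.  Its proof uses nothing about `λ` except `λ ∈ {±1}`; here it is repeated for an ARBITRARY `±1`-valued
weight `σ : ℤ → ℝ` (the consumer takes `σ = ∏_{i∈S} λ(ψ_i(·))`, any `S ⊆ [t]`):

* `signed_sifted_sum_le_of_sign` — for `F ∈ ℤ[X]` whose root density has a sieve dimension, an integer
  interval `I = [m₁, m₂]` on which `F > 0`, a sifting level `2 ≤ z ≤ D` and a constant `C_FL` for which the
  (uniform) Fundamental Lemma holds (tree: `SieveSequence.fundamental_lemma_uniform_holds`):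
  `|Σ_{m ∈ I, (F(m), P(z)) = 1} σ(m)| ≤ C_FL · #I · V(z) · e^{−log D/log z}
      + Σ_{d ≤ D sqfree} Σ_{s mod d, d ∣ F(s)} (1 + |Σ_{m ∈ I, m ≡ s (d)} σ(m)|)`.
  Proof: split by the sign `ν = σ(m)` into the two value sequences `valSeq F S_ν (#I/2)`; both have density
  `ω_F(m)/m` and size `#I/2`, so the two main terms `X V(z)` of the Fundamental Lemma CANCEL, leaving
  `2 C_FL (#I/2) V(z) e^{-s}`; the class counts of `S_ν` are `½ #{m ∈ I : m ≡ s} + ½ ν Σ_{m ≡ s} σ(m)`.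

References: J. Friedlander, H. Iwaniec, *Opera de Cribro* (2010), Cor. 6.10 [FriedlanderIwaniecOpera2010];
H. Halberstam, H.-E. Richert, *Sieve Methods* (1974), Thm. 2.5 [HalberstamRichert1974].
-/

noncomputable section

open Finset Polynomial ArithmeticFunction

namespace Summit.Parity.GeneralizedHardyLittlewood.Cruxes.PrimeCellsRelative.SieveOutToChowla

open Literature.NumberTheory.Sieve
open Summit.Parity.GeneralizedHardyLittlewood.Theorems.AbsoluteUpgrade

/-! ### Sign classes of an arbitrary `±1` weight -/

/-- `Σ_{m ∈ T} σ(m) = #{σ = 1} − #{σ = −1}` when `σ ∈ {±1}` on `T`. [folklore] -/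
theorem sum_sign_eq_card_sub_card (T : Finset ℤ) {σ : ℤ → ℝ} (hσ : ∀ m ∈ T, σ m = 1 ∨ σ m = -1) :
    ∑ m ∈ T, σ m =
      (#(T.filter (fun m : ℤ => σ m = 1)) : ℝ) - #(T.filter (fun m : ℤ => σ m = -1)) := by
  rw [Finset.card_eq_sum_ones, Finset.card_eq_sum_ones, Nat.cast_sum, Nat.cast_sum,
    Finset.sum_filter, Finset.sum_filter, ← Finset.sum_sub_distrib]
  refine Finset.sum_congr rfl fun m hm => ?_
  rcases hσ m hm with h | h <;> simp [h] <;> norm_num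

/-- **Counting a sign class**: if `σ ∈ {±1}` on `T` and `ν ∈ {±1}`,
`#{m ∈ T : σ(m) = ν} = ½ #T + ½ ν Σ_{m ∈ T} σ(m)`. [folklore] -/
theorem card_filter_sign_eq (T : Finset ℤ) {σ : ℤ → ℝ} (hσ : ∀ m ∈ T, σ m = 1 ∨ σ m = -1) {ν : ℤ}
    (hν : ν = 1 ∨ ν = -1) :
    (#(T.filter (fun m : ℤ => σ m = ν)) : ℝ) =
      (1 / 2) * #T + (1 / 2) * ν * ∑ m ∈ T, σ m := by
  rw [Finset.card_eq_sum_ones, Nat.cast_sum, Finset.sum_filter, Finset.card_eq_sum_ones,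
    Nat.cast_sum, Finset.mul_sum, Finset.mul_sum, ← Finset.sum_add_distrib]
  refine Finset.sum_congr rfl fun m hm => ?_
  push_cast
  rcases hσ m hm with h | h <;> rcases hν with rfl | rfl <;> simp [h] <;> norm_num

set_option maxHeartbeats 800000 in
/-- **Sieving out a signed sequence (the two main terms cancel).** See the module docstring; the `±1` weight
`σ` is arbitrary (the sibling line's `signed_sifted_sum_le` is the case `σ = λ(a · + b)`).
[cite: FriedlanderIwaniecOpera2010, Cor. 6.10] -/
theorem signed_sifted_sum_le_of_sign' {κ K CFL : ℝ}
    (hFL : ∀ A : SieveSequence, HasSieveDimension A.density κ K → ∀ x z D : ℝ, 2 ≤ z → z ≤ D →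
      0 ≤ A.size x → |A.sifted x (primesProdBelow z) - A.size x * A.densityProduct (primesProdBelow z)| ≤
        CFL * A.size x * A.densityProduct (primesProdBelow z) * Real.exp (-(Real.log D / Real.log z)) +
          ∑ d ∈ (primesProdBelow z).divisors.filter (fun d : ℕ => (d : ℝ) ≤ D), |A.remainder d x|)
    {F : Polynomial ℤ} (hdim : HasSieveDimension (rootDensity F) κ K) {m₁ m₂ : ℤ} {σ : ℤ → ℝ}
    (hσ : ∀ m ∈ Icc m₁ m₂, σ m = 1 ∨ σ m = -1) {xF : ℝ}
    (hxF : ∀ m ∈ Icc m₁ m₂, 0 < F.eval m ∧ ((F.eval m : ℤ) : ℝ) ≤ xF) {z D : ℝ} (hz : 2 ≤ z) (hzD : z ≤ D) :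
    |∑ m ∈ (Icc m₁ m₂).filter (fun m : ℤ => (F.eval m).natAbs.Coprime (primesProdBelow z)), σ m| ≤
      CFL * #(Icc m₁ m₂) * (∏ p ∈ Nat.primesBelow ⌈z⌉₊, (1 - (polyRootCountMod ![F] p : ℝ) / p)) *
          Real.exp (-(Real.log D / Real.log z)) +
        ∑ d ∈ (Icc 1 ⌊D⌋₊).filter Squarefree, ∑ s ∈ rootsMod F d,
          (1 + |∑ m ∈ (Icc m₁ m₂).filter (fun m : ℤ => m ≡ (s : ℤ) [ZMOD d]), σ m|) := by
  -- adapted from `Theorems.AbsoluteUpgrade.signed_sifted_sum_le` (sibling line, crux AbsoluteUpgrade)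
  set I := Icc m₁ m₂ with hIdef
  set P := primesProdBelow z with hP
  set V := ∏ p ∈ Nat.primesBelow ⌈z⌉₊, (1 - (polyRootCountMod ![F] p : ℝ) / p) with hVdef
  set E := Real.exp (-(Real.log D / Real.log z)) with hE
  set X : ℝ := #I / 2 with hX
  set Lam : ℕ → ℕ → ℝ := fun d s => ∑ m ∈ I.filter (fun m : ℤ => m ≡ (s : ℤ) [ZMOD d]), σ m with hLam
  set S : ℤ → Finset ℤ := fun ν => I.filter (fun m : ℤ => σ m = ν) with hS
  have hxS : ∀ ν, ∀ m ∈ S ν, 0 < F.eval m ∧ ((F.eval m : ℤ) : ℝ) ≤ xF := fun ν m hm =>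
    hxF m (Finset.mem_filter.mp hm).1
  set A : ℤ → SieveSequence := fun ν => valSeq F (S ν) X with hA
  have hX0 : 0 ≤ X := by positivity
  have hV0 : 0 ≤ V := Finset.prod_nonneg fun p _ => by
    have := rootDensity_le_one F p
    rw [rootDensity_apply] at this
    linarith
  -- the moduli `d ∣ P(z)`, `d ≤ D` are squarefree numbers in `[1, ⌊D⌋]`
  have hdivsub : P.divisors.filter (fun d : ℕ => (d : ℝ) ≤ D) ⊆ (Icc 1 ⌊D⌋₊).filter Squarefree := by
    intro d hd
    rw [Finset.mem_filter, Nat.mem_divisors] at hd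
    rw [Finset.mem_filter, Finset.mem_Icc]
    exact ⟨⟨Nat.pos_of_dvd_of_pos hd.1.1 (Nat.pos_of_ne_zero hd.1.2), Nat.le_floor hd.2⟩,
      (squarefree_primesProdBelow z).squarefree_of_dvd hd.1.1⟩
  -- the sifted sums count the sign classes of the sifted points
  have hsift : ∀ ν, (A ν).sifted xF P =
      #((I.filter (fun m : ℤ => (F.eval m).natAbs.Coprime P)).filter (fun m : ℤ => σ m = ν)) := by
    intro ν
    rw [hA, valSeq_sifted F (S ν) X (hxS ν) P, hS, Finset.filter_filter, Finset.filter_filter]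
    congr 2
    refine Finset.filter_congr fun m _ => ?_
    exact and_comm
  have hsize : ∀ ν x, (A ν).size x = X := fun ν x => rfl
  have hdens : ∀ ν, (A ν).densityProduct P = V := fun ν => valSeq_densityProduct F (S ν) X z
  -- the Fundamental Lemma for each sign
  have hFLν : ∀ ν, |(A ν).sifted xF P - X * V| ≤ CFL * X * V * E +
      ∑ d ∈ P.divisors.filter (fun d : ℕ => (d : ℝ) ≤ D), |(A ν).remainder d xF| := by
    intro ν
    have h := hFL (A ν) hdim xF z D hz hzD (by rw [hsize]; exact hX0)
    rwa [hdens ν, hsize] at h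
  -- the remainders, class by class
  have hσI : ∀ (d : ℕ) (s : ℕ), ∀ m ∈ I.filter (fun m : ℤ => m ≡ (s : ℤ) [ZMOD d]), σ m = 1 ∨ σ m = -1 :=
    fun d s m hm => hσ m (Finset.mem_filter.mp hm).1
  have hRd : ∀ ν : ℤ, (ν = 1 ∨ ν = -1) → ∀ d ∈ P.divisors.filter (fun d : ℕ => (d : ℝ) ≤ D),
      |(A ν).remainder d xF| ≤ (1 / 2) * ∑ s ∈ rootsMod F d, (1 + |Lam d s|) := by
    intro ν hν d hd
    have hd0 : 0 < d := Nat.pos_of_mem_divisors (Finset.mem_filter.mp hd).1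
    refine (abs_valSeq_remainder_le F (S ν) X (hxS ν) hd0).trans ?_
    rw [Finset.mul_sum]
    refine Finset.sum_le_sum fun s _ => ?_
    have hset : (S ν).filter (fun n : ℤ => n ≡ (s : ℤ) [ZMOD d]) =
        (I.filter (fun m : ℤ => m ≡ (s : ℤ) [ZMOD d])).filter (fun m : ℤ => σ m = ν) := by
      rw [hS, Finset.filter_filter, Finset.filter_filter]
      exact Finset.filter_congr fun m _ => and_comm
    have hcl := card_filter_sign_eq (I.filter (fun m : ℤ => m ≡ (s : ℤ) [ZMOD d])) (hσI d s) hν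
    have hcnt := abs_card_Icc_filter_modEq_sub_le hd0 m₁ m₂ (s : ℤ)
    rw [hset, hcl]
    have hνabs : |((ν : ℤ) : ℝ)| = 1 := by rcases hν with rfl | rfl <;> simp
    calc |(1 / 2 : ℝ) * #(I.filter (fun m : ℤ => m ≡ (s : ℤ) [ZMOD d])) +
            (1 / 2) * ν * Lam d s - X / d|
        = |(1 / 2 : ℝ) * ((#(I.filter (fun m : ℤ => m ≡ (s : ℤ) [ZMOD d])) : ℝ) - (#I : ℝ) / d) +
            (1 / 2) * ν * Lam d s| := by rw [hX]; ring_nf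
      _ ≤ |(1 / 2 : ℝ) * ((#(I.filter (fun m : ℤ => m ≡ (s : ℤ) [ZMOD d])) : ℝ) - (#I : ℝ) / d)| +
            |(1 / 2 : ℝ) * ν * Lam d s| := abs_add_le _ _
      _ ≤ (1 / 2) * 1 + (1 / 2) * |Lam d s| := by
          rw [abs_mul, abs_mul, abs_mul, hνabs, abs_of_pos (by norm_num : (0 : ℝ) < 1 / 2)]
          have := mul_le_mul_of_nonneg_left hcnt (by norm_num : (0 : ℝ) ≤ 1 / 2)
          linarith
      _ = (1 / 2) * (1 + |Lam d s|) := by ring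
  have hRsum : ∀ ν : ℤ, (ν = 1 ∨ ν = -1) →
      ∑ d ∈ P.divisors.filter (fun d : ℕ => (d : ℝ) ≤ D), |(A ν).remainder d xF| ≤
        (1 / 2) * ∑ d ∈ (Icc 1 ⌊D⌋₊).filter Squarefree, ∑ s ∈ rootsMod F d, (1 + |Lam d s|) := by
    intro ν hν
    calc _ ≤ ∑ d ∈ P.divisors.filter (fun d : ℕ => (d : ℝ) ≤ D),
          (1 / 2) * ∑ s ∈ rootsMod F d, (1 + |Lam d s|) := Finset.sum_le_sum (hRd ν hν)
      _ = (1 / 2) * ∑ d ∈ P.divisors.filter (fun d : ℕ => (d : ℝ) ≤ D),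
          ∑ s ∈ rootsMod F d, (1 + |Lam d s|) := by rw [Finset.mul_sum]
      _ ≤ _ := by
          refine mul_le_mul_of_nonneg_left ?_ (by norm_num)
          exact Finset.sum_le_sum_of_subset_of_nonneg hdivsub
            fun d _ _ => Finset.sum_nonneg fun s _ => by positivity
  -- assembly
  have hsum : ∑ m ∈ I.filter (fun m : ℤ => (F.eval m).natAbs.Coprime P), σ m =
      (A 1).sifted xF P - (A (-1)).sifted xF P := by
    rw [hsift 1, hsift (-1)]
    push_cast
    exact sum_sign_eq_card_sub_card _ (fun m hm => hσ m (Finset.mem_filter.mp hm).1)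
  rw [hsum]
  have h1 := hFLν 1
  have h2 := hFLν (-1)
  have hR1 := hRsum 1 (Or.inl rfl)
  have hR2 := hRsum (-1) (Or.inr rfl)
  calc |(A 1).sifted xF P - (A (-1)).sifted xF P|
      = |((A 1).sifted xF P - X * V) - ((A (-1)).sifted xF P - X * V)| := by ring_nf
    _ ≤ |(A 1).sifted xF P - X * V| + |(A (-1)).sifted xF P - X * V| := abs_sub _ _
    _ ≤ (CFL * X * V * E + (1 / 2) * ∑ d ∈ (Icc 1 ⌊D⌋₊).filter Squarefree,
            ∑ s ∈ rootsMod F d, (1 + |Lam d s|)) +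
          (CFL * X * V * E + (1 / 2) * ∑ d ∈ (Icc 1 ⌊D⌋₊).filter Squarefree,
            ∑ s ∈ rootsMod F d, (1 + |Lam d s|)) :=
        add_le_add (h1.trans (add_le_add le_rfl hR1)) (h2.trans (add_le_add le_rfl hR2))
    _ = CFL * #I * V * E + ∑ d ∈ (Icc 1 ⌊D⌋₊).filter Squarefree,
          ∑ s ∈ rootsMod F d, (1 + |Lam d s|) := by rw [hX]; ring

/-- **Sieving out a signed sequence — registered form** (sub-goal `signed_sifted_sum_le_of_sign` of stmt-Parity-14112,
helper for `stub_sieveTransfer`; uncurried statement of `signed_sifted_sum_le_of_sign'`).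
[cite: FriedlanderIwaniecOpera2010, Cor. 6.10] -/
theorem signed_sifted_sum_le_of_sign : ∀ {κ K CFL : ℝ}, (∀ A : SieveSequence, HasSieveDimension A.density κ K → ∀ x z D : ℝ, 2 ≤ z → z ≤ D → 0 ≤ A.size x → |A.sifted x (primesProdBelow z) - A.size x * A.densityProduct (primesProdBelow z)| ≤ CFL * A.size x * A.densityProduct (primesProdBelow z) * Real.exp (-(Real.log D / Real.log z)) + ∑ d ∈ (primesProdBelow z).divisors.filter (fun d : ℕ => (d : ℝ) ≤ D), |A.remainder d x|) → ∀ {F : Polynomial ℤ}, HasSieveDimension (rootDensity F) κ K → ∀ {m₁ m₂ : ℤ} {σ : ℤ → ℝ}, (∀ m ∈ Icc m₁ m₂, σ m = 1 ∨ σ m = -1) → ∀ {xF : ℝ}, (∀ m ∈ Icc m₁ m₂, 0 < F.eval m ∧ ((F.eval m : ℤ) : ℝ) ≤ xF) → ∀ {z D : ℝ}, 2 ≤ z → z ≤ D → |∑ m ∈ (Icc m₁ m₂).filter (fun m : ℤ => (F.eval m).natAbs.Coprime (primesProdBelow z)), σ m| ≤ CFL * #(Icc m₁ m₂) * (∏ p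 ∈ Nat.primesBelow ⌈z⌉₊, (1 - (polyRootCountMod ![F] p : ℝ) / p)) * Real.exp (-(Real.log D / Real.log z)) + ∑ d ∈ (Icc 1 ⌊D⌋₊).filter Squarefree, ∑ s ∈ rootsMod F d, (1 + |∑ m ∈ (Icc m₁ m₂).filter (fun m : ℤ => m ≡ (s : ℤ) [ZMOD d]), σ m|) := by
  intro κ K CFL hFL F hdim m₁ m₂ σ hσ xF hxF z D hz hzD
  exact signed_sifted_sum_le_of_sign' hFL hdim hσ hxF hz hzD

end Summit.Parity.GeneralizedHardyLittlewood.Cruxes.PrimeCellsRelative.SieveOutToChowla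

end
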